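import Summits.AtomisticToContinuum.HydrodynamicLimit.Theorems.LambertianContactSwapLambertianEulerHeartsLog
import Summits.AtomisticToContinuum.HydrodynamicLimit.Theorems.LambertianContactSwapLambertianEulerEstimateOfHearts
import Summits.AtomisticToContinuum.HydrodynamicLimit.Theorems.LambertianContactSwapLambertianEulerDiscreteEntropyGronwallLog
import Summits.AtomisticToContinuum.HydrodynamicLimit.Theorems.LambertianContactSwapLambertianEulerDock
import Summits.AtomisticToContinuum.HydrodynamicLimit.Theorems.LambertianContactSwapLambertianEulerKlLedger
import Summits.AtomisticToContinuum.HydrodynamicLimit.Theorems.TwoClocksClampedEntropyClockTimeZeroReference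
import Summits.AtomisticToContinuum.HydrodynamicLimit.Theorems.TwoClocksClampedEntropyClockKlDivLawAtLocalGibbsNeTop
import HarnessLib

/-!
# Guarded ESTIMATE ⇒ BOUND ⇒ WINDOW STEP ⇒ GRONWALL for the Lambertian entropy clock, with no dilute self-consistency (line `Sketch`, crux stmt-11854)

Support file (`--supports stmt-AtomisticToContinuum-11854`).  The packing-guarded, log-shell clock chain of the line `Sketch`:
`windowProductionBoundLambdaInBand_of_estimate`, `windowStepLambdaInBand_of_bound`, `gronwallRfLambdaInBand_of_windowStep`
(statements in `…LambertianEulerHeartsLog`).  These are lead c6's `…OfHearts` steps with the premise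
`ImplosionDichotomy.DiluteSelfConsistency` (stmt-3091, expected false) REPLACED by the packing guard of the re-typed conjunct (D-0032):
each step shrinks the band (`min` with the analytic insertion factor's band, resp. `r/2`) instead of invoking stmt-3091, and the
Gronwall step consumes the log-shell window Gronwall `…DiscreteEntropyGronwallLog.discreteEntropyGronwall_log` (rate `A ≤ κ|log ε|`
chosen after `ε`).  Everything else is verbatim (FORMULA p128635, one-window ledger p122335, time-zero reference p101191, ledger
finiteness p120487).  Lead prover-line-stmt-AtomisticToContinuum-11854-c7-0, 2026-08-17.  [cite: Yau1991, §2]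
-/

noncomputable section

namespace Summit.AtomisticToContinuum.HydrodynamicLimit.Theorems.LambertianContactSwapLambertianEulerOfHeartsInBand

open scoped BigOperators Topology ENNReal InnerProductSpace
open MeasureTheory ProbabilityTheory Filter Set InformationTheory
open Literature.MathematicalPhysics.KineticTheory
open Literature.Analysis.FluidPDE Literature.Analysis.FluidPDE.Alexander
open Summit.AtomisticToContinuum.HydrodynamicLimit.Theorems.ClampedCurrentsDockPathwise (gSum DgSum)
open Summit.AtomisticToContinuum.HydrodynamicLimit.Theorems.LambertianContactSwapLambertianEulerHearts
open Summit.AtomisticToContinuum.HydrodynamicLimit.Theorems.LambertianContactSwapLambertianEulerHeartsLog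
open Summit.AtomisticToContinuum.HydrodynamicLimit.Theorems.LambertianContactSwapLambertianEulerEstimateOfHearts

/-- **guarded ESTIMATE ⇒ guarded BOUND** through the FORMULA (p128635) and the joint smoothness of the explicit activity
(`isSmoothSpaceTimeOn_activityRf`; the packing guard keeps `σ³ρ` in its band). [cite: Yau1991, §2] -/
theorem windowProductionBoundLambdaInBand_of_estimate (hEst : WindowProductionEstimateLambdaInBand) :
    WindowProductionBoundLambdaInBand := by
  intro r Rf hr hsol hbd hcont huniq
  obtain ⟨ηE, hηE, HE⟩ := hEst r Rf hr hsol hbd hcont huniq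
  obtain ⟨η, hη, hηr, Hsm⟩ := isSmoothSpaceTimeOn_activityRf hr huniq
  -- the band: the estimate's band and the analytic insertion factor's band (what stmt-3091 used to supply)
  refine ⟨min ηE η, lt_min hηE hη, fun a₀ θ₀ u₀ ha hθ hu ha0 hθ0 => ?_⟩
  obtain ⟨σE, hσE, HE⟩ := HE a₀ θ₀ u₀ ha hθ hu ha0 hθ0
  refine ⟨min σE 2⁻¹, lt_min hσE (by norm_num), ?_⟩
  intro σ hσ hσlt T ρ θ u hEul hband Φ htie t ht
  have hσE' : σ < σE := hσlt.trans_le (min_le_left _ _)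
  have hσi : σ < 2⁻¹ := hσlt.trans_le (min_le_right _ _)
  have hbandE : ∀ t' ∈ Set.Ico 0 T, ∀ x, ρ t' x * σ ^ 3 < ηE := fun t' ht' x =>
    (hband t' ht' x).trans_le (min_le_left _ _)
  have HA := HE σ hσ hσE' T ρ θ u hEul hbandE Φ htie t ht
  have hσ3 : 0 < σ ^ 3 := by positivity
  have hrange : ∀ t' ∈ Set.Ico 0 T, ∀ x, 0 < σ ^ 3 * ρ t' x ∧ σ ^ 3 * ρ t' x < η := fun t' ht' x =>
    ⟨mul_pos hσ3 (hEul.density_pos t' ht' x), by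
      have h := (hband t' ht' x).trans_le (min_le_right _ _); nlinarith [h]⟩
  have hsmooth : Literature.Analysis.FunctionSpaces.Torus.IsSmoothSpaceTimeOn (Set.Ico 0 T)
      (fun r' x => ρ r' x * Rf (σ ^ 3 * ρ r' x)) := Hsm hEul.smooth_density hrange
  have hapos : ∀ t' ∈ Set.Ico 0 T, ∀ x, 0 < ρ t' x * Rf (σ ^ 3 * ρ t' x) := fun t' ht' x =>
    mul_pos (hEul.density_pos t' ht' x)
      (hsol _ ⟨by linarith [(hrange t' ht' x).1], (hrange t' ht' x).2.trans_le hηr⟩).1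
  intro κ hκ
  obtain ⟨ε₀, hε₀, Hε⟩ := HA κ hκ
  refine ⟨ε₀, hε₀, fun ε hε hεlt => ?_⟩
  obtain ⟨A, hA, hAle, w, hw, N₀, HN⟩ := Hε ε hε hεlt
  refine ⟨A, hA, hAle, w, hw, N₀, fun N hN => ?_⟩
  obtain ⟨H1, H2⟩ := HN N hN
  constructor
  · intro s hs hsw
    have hF := (Summit.AtomisticToContinuum.HydrodynamicLimit.Theorems.LambertianContactSwapLambertianEulerExpectedWindowProduction.stub_expectedWindowProductionLambda hσ hσi ha hθ hu ha0 hθ0 T N (Φ N)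
      (fun r' x => ρ r' x * Rf (σ ^ 3 * ρ r' x)) θ u hsmooth hEul.smooth_temperature hEul.smooth_velocity
      hapos hEul.temperature_pos s (w N) hs (hw N).le (by linarith [ht.2])).2.2
    beta_reduce at hF
    exact (le_of_eq hF).trans (H1 s hs hsw)
  · intro s hs hst htsw
    have hF := (Summit.AtomisticToContinuum.HydrodynamicLimit.Theorems.LambertianContactSwapLambertianEulerExpectedWindowProduction.stub_expectedWindowProductionLambda hσ hσi ha hθ hu ha0 hθ0 T N (Φ N)
      (fun r' x => ρ r' x * Rf (σ ^ 3 * ρ r' x)) θ u hsmooth hEul.smooth_temperature hEul.smooth_velocity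
      hapos hEul.temperature_pos s (t - s) hs (by linarith) (by linarith [ht.2])).2.2
    beta_reduce at hF
    simp only [show s + (t - s) = t by ring] at hF
    exact (le_of_eq hF).trans (H2 s hs hst htsw)

/-- **guarded BOUND ⇒ guarded WINDOW STEP** through the one-window ledger (p122335): `(1 + A w) H = H + A w H`; the guard at `r/2` keeps `σ³ρ_s` in the domain of `Rf`. [cite: Yau1991, §2] -/
theorem windowStepLambdaInBand_of_bound (hB : WindowProductionBoundLambdaInBand) :
    WindowStepLambdaInBand := by
  intro r Rf hr hsol hbd hcont huniq
  obtain ⟨ηB, hηB, Hb⟩ := hB r Rf hr hsol hbd hcont huniq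
  -- the band: the bound's band, and `r/2` to keep `σ³ρ_s` inside the domain of `Rf` (what stmt-3091 used to supply)
  refine ⟨min ηB (r / 2), lt_min hηB (by positivity), fun a₀ θ₀ u₀ ha hθ hu ha0 hθ0 => ?_⟩
  obtain ⟨σb, hσb, Hb⟩ := Hb a₀ θ₀ u₀ ha hθ hu ha0 hθ0
  refine ⟨min σb (1 / 2), lt_min hσb (by norm_num), ?_⟩
  intro σ hσ hσlt T ρ θ u hE hband Φ htie t ht
  have hσb' : σ < σb := hσlt.trans_le (min_le_left _ _)
  have hσ2' : σ < 1 / 2 := hσlt.trans_le (min_le_right _ _)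
  have hbandB : ∀ t' ∈ Set.Ico 0 T, ∀ x, ρ t' x * σ ^ 3 < ηB := fun t' ht' x =>
    (hband t' ht' x).trans_le (min_le_left _ _)
  have hσi : σ < 2⁻¹ := by rw [inv_eq_one_div]; exact hσ2'
  -- the reference profiles along `[0, t]`: continuity and positivity
  have href : ∀ s ∈ Set.Icc 0 t, (Continuous fun x => ρ s x * Rf (σ ^ 3 * ρ s x)) ∧
      (∀ x, 0 < ρ s x * Rf (σ ^ 3 * ρ s x)) ∧ Continuous (θ s) ∧ Continuous (u s) ∧ ∀ x, 0 < θ s x := by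
    intro s hs
    have hsI : s ∈ Set.Ico 0 T := ⟨hs.1, hs.2.trans_lt ht.2⟩
    have hρc : Continuous (ρ s) := (hE.smooth_density.isSmooth_slice hsI).continuous
    have huc : Continuous (u s) := (hE.smooth_velocity.isSmooth_slice hsI).continuous
    have hθc : Continuous (θ s) := (hE.smooth_temperature.isSmooth_slice hsI).continuous
    have hρpos : ∀ x, 0 < ρ s x := hE.density_pos s hsI
    have hθpos : ∀ x, 0 < θ s x := hE.temperature_pos s hsI
    have hσ3 : 0 < σ ^ 3 := by positivity
    have hmem : ∀ x, σ ^ 3 * ρ s x ∈ Set.Icc 0 r := fun x => by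
      have h := (hband s hsI x).trans_le (min_le_right _ _)
      exact ⟨(mul_pos hσ3 (hρpos x)).le, by nlinarith [h, hρpos x, hr]⟩
    have hbc : Continuous fun x => ρ s x * Rf (σ ^ 3 * ρ s x) :=
      hρc.mul (hcont.comp_continuous (continuous_const.mul hρc) hmem)
    have hbpos : ∀ x, 0 < ρ s x * Rf (σ ^ 3 * ρ s x) := fun x =>
      mul_pos (hρpos x) (one_pos.trans_le (hbd _ (hmem x)).1)
    exact ⟨hbc, hbpos, hθc, huc, hθpos⟩
  have H := Hb σ hσ hσb' T ρ θ u hE hbandB Φ htie t ht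
  intro κ hκ
  obtain ⟨ε₀, hε₀, Hε⟩ := H κ hκ
  refine ⟨ε₀, hε₀, fun ε hε hεlt => ?_⟩
  obtain ⟨A, hA, hAle, w, hw, N₀, HN⟩ := Hε ε hε hεlt
  refine ⟨A, hA, hAle, w, hw, N₀, fun N hN => ?_⟩
  obtain ⟨hfull, hpart⟩ := HN N hN
  constructor
  · intro s hs hsw
    have hs' : s ∈ Set.Icc 0 t := ⟨hs, by linarith [hw N]⟩
    have hsw' : s + w N ∈ Set.Icc 0 t := ⟨by linarith [hw N], hsw⟩
    obtain ⟨hb, hbp, hθc, huc, hθp⟩ := href s hs'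
    obtain ⟨hb', hbp', hθc', huc', hθp'⟩ := href (s + w N) hsw'
    have hL := (Summit.AtomisticToContinuum.HydrodynamicLimit.Theorems.LambertianContactSwapLambertianEulerWindowLedger.stub_windowLedgerLambda hσ hσi ha hθ hu ha0 hθ0 hb hθc huc hbp hθp hb' hθc' huc' hbp' hθp'
      N (Φ N) s (w N) hs (hw N).le).2
    have hP := hfull s hs hsw
    unfold Hent at hP ⊢
    have hring : (1 + A * w N) * (klDiv (((localGibbsLaw σ a₀ u₀ θ₀ N (Φ N)).prod (lambertNoise (Fin 3))).map
        (fun p => lambertFlow (Torus.geometry (Fin 3)) (hsDiameter σ N) p.2 p.1 s))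
        (localGibbsLaw σ (fun x => ρ s x * Rf (σ ^ 3 * ρ s x)) (u s) (θ s) N (Φ N))).toReal =
      (klDiv (((localGibbsLaw σ a₀ u₀ θ₀ N (Φ N)).prod (lambertNoise (Fin 3))).map
        (fun p => lambertFlow (Torus.geometry (Fin 3)) (hsDiameter σ N) p.2 p.1 s))
        (localGibbsLaw σ (fun x => ρ s x * Rf (σ ^ 3 * ρ s x)) (u s) (θ s) N (Φ N))).toReal + A * w N * (klDiv (((localGibbsLaw σ a₀ u₀ θ₀ N (Φ N)).prod (lambertNoise (Fin 3))).map
        (fun p => lambertFlow (Torus.geometry (Fin 3)) (hsDiameter σ N) p.2 p.1 s))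
        (localGibbsLaw σ (fun x => ρ s x * Rf (σ ^ 3 * ρ s x)) (u s) (θ s) N (Φ N))).toReal := by ring
    rw [hring]
    linarith
  · intro s hs hst htw
    have hs' : s ∈ Set.Icc 0 t := ⟨hs, hst⟩
    obtain ⟨hb, hbp, hθc, huc, hθp⟩ := href s hs'
    obtain ⟨hb', hbp', hθc', huc', hθp'⟩ := href t ⟨ht.1.le, le_rfl⟩
    have hL := (Summit.AtomisticToContinuum.HydrodynamicLimit.Theorems.LambertianContactSwapLambertianEulerWindowLedger.stub_windowLedgerLambda hσ hσi ha hθ hu ha0 hθ0 hb hθc huc hbp hθp hb' hθc' huc' hbp' hθp'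
      N (Φ N) s (t - s) hs (sub_nonneg.2 hst)).2
    rw [show s + (t - s) = t by ring] at hL
    have hP := hpart s hs hst htw
    unfold Hent at hP ⊢
    linarith

/-- **guarded WINDOW STEP ⇒ guarded GRONWALL** along the explicit reference family: `H_N(0) = 0` (time-zero reference p101191 + `map_lambertFlow_zero_localGibbsLaw`), finiteness of the entropies on `[0, t]` (ledger p120487; the guard at `r/2`), and the log-shell window Gronwall `discreteEntropyGronwall_log`. [cite: Yau1991, §2] -/
theorem gronwallRfLambdaInBand_of_windowStep : Summit.AtomisticToContinuum.HydrodynamicLimit.Theorems.LambertianContactSwapLambertianEulerHeartsLog.WindowStepLambdaInBand → Summit.AtomisticToContinuum.HydrodynamicLimit.Theorems.LambertianContactSwapLambertianEulerHeartsLog.GronwallRfLambdaInBand := by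
  intro hW r Rf hr hsol hbd hcont huniq
  obtain ⟨ηB, hηB, Hb⟩ := hW r Rf hr hsol hbd hcont huniq
  -- the band: the step's band, and `r/2` to keep `σ³ρ_s` inside the domain of `Rf` (what stmt-3091 used to supply)
  refine ⟨min ηB (r / 2), lt_min hηB (by positivity), fun a₀ θ₀ u₀ ha hθ hu ha0 hθ0 => ?_⟩
  obtain ⟨σb, hσb, Hb⟩ := Hb a₀ θ₀ u₀ ha hθ hu ha0 hθ0
  obtain ⟨σc, hσc, Hc⟩ :=
    Summit.AtomisticToContinuum.HydrodynamicLimit.Theorems.QuenchedCellClock.stub_timeZeroReference hr hsol hbd hcont huniq a₀ θ₀ u₀ ha hθ hu ha0 hθ0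
  refine ⟨min σb (min σc (1 / 2)), lt_min hσb (lt_min hσc (by norm_num)), ?_⟩
  intro σ hσ hσlt T ρ θ u hE hband Φ htie t ht _hac _hap _hale _hQs _hlim
  have hσb' : σ < σb := hσlt.trans_le (min_le_left _ _)
  have hσc' : σ < σc := hσlt.trans_le ((min_le_right _ _).trans (min_le_left _ _))
  have hσ2' : σ < 1 / 2 := hσlt.trans_le ((min_le_right _ _).trans (min_le_right _ _))
  have hbandB : ∀ t' ∈ Set.Ico 0 T, ∀ x, ρ t' x * σ ^ 3 < ηB := fun t' ht' x =>
    (hband t' ht' x).trans_le (min_le_left _ _)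
  have hσ2 : σ ≤ 1 / 2 := hσ2'.le
  have hσi : σ < 2⁻¹ := by rw [inv_eq_one_div]; exact hσ2'
  have hT0 : 0 < T := ht.1.trans ht.2
  have hstep := Hb σ hσ hσb' T ρ θ u hE hbandB Φ htie t ht
  have hlaw := Hc σ hσ hσc' T ρ θ u hE hT0 Φ htie
  -- finiteness of the relative entropies along the explicit reference family on `[0, t]` (ledger, clause 1)
  have hfin : ∀ (N : ℕ) (s : ℝ), s ∈ Set.Icc 0 t →
      klDiv (((localGibbsLaw σ a₀ u₀ θ₀ N (Φ N)).prod (lambertNoise (Fin 3))).map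
          (fun p => lambertFlow (Torus.geometry (Fin 3)) (hsDiameter σ N) p.2 p.1 s))
        (localGibbsLaw σ (fun x => ρ s x * Rf (σ ^ 3 * ρ s x)) (u s) (θ s) N (Φ N)) ≠ ⊤ := by
    intro N s hs
    have hsI : s ∈ Set.Ico 0 T := ⟨hs.1, hs.2.trans_lt ht.2⟩
    have hρc : Continuous (ρ s) := (hE.smooth_density.isSmooth_slice hsI).continuous
    have huc : Continuous (u s) := (hE.smooth_velocity.isSmooth_slice hsI).continuous
    have hθc : Continuous (θ s) := (hE.smooth_temperature.isSmooth_slice hsI).continuous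
    have hρpos : ∀ x, 0 < ρ s x := hE.density_pos s hsI
    have hθpos : ∀ x, 0 < θ s x := hE.temperature_pos s hsI
    have hσ3 : 0 < σ ^ 3 := by positivity
    have hmem : ∀ x, σ ^ 3 * ρ s x ∈ Set.Icc 0 r := fun x => by
      have h := (hband s hsI x).trans_le (min_le_right _ _)
      exact ⟨(mul_pos hσ3 (hρpos x)).le, by nlinarith [h, hρpos x, hr]⟩
    have hbc : Continuous fun x => ρ s x * Rf (σ ^ 3 * ρ s x) :=
      hρc.mul (hcont.comp_continuous (continuous_const.mul hρc) hmem)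
    have hbpos : ∀ x, 0 < ρ s x * Rf (σ ^ 3 * ρ s x) := fun x =>
      mul_pos (hρpos x) (one_pos.trans_le (hbd _ (hmem x)).1)
    haveI := isProbabilityMeasure_localGibbsLaw ha hθ hu ha0 hθ0 hσ2 N (Φ N)
    have hPL : localGibbsLaw σ a₀ u₀ θ₀ N (Φ N) ≪
        liouville (Torus.geometry (Fin 3)) (N + 1) (hsDiameter σ N) := by
      rw [localGibbsLaw, particleLaw_eq]; exact withDensity_absolutelyContinuous _ _
    have hEn := Summit.AtomisticToContinuum.HydrodynamicLimit.Theorems.QuenchedCellClock.integrable_sum_norm_sq_localGibbsLaw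
      ha hθ hu (fun x => (ha0 x).le) hθ0 N (Φ N)
    have hK0 : klDiv (localGibbsLaw σ a₀ u₀ θ₀ N (Φ N)) (localGibbsLaw σ a₀ u₀ θ₀ N (Φ N)) ≠ ⊤ := by
      rw [klDiv_self]; exact ENNReal.zero_ne_top
    exact (Summit.AtomisticToContinuum.HydrodynamicLimit.Theorems.LambertianContactSwapLambertianEulerKlLedger.stub_klLedgerLambda hσ hσi ha hθ hu ha0 hθ0 hbc hθc huc hbpos hθpos N (Φ N)
      (localGibbsLaw σ a₀ u₀ θ₀ N (Φ N)) hPL hEn hK0 s hs.1).1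
  -- the real-valued entropies along the explicit reference family
  set H : ℕ → ℝ → ℝ := fun N s =>
    (klDiv (((localGibbsLaw σ a₀ u₀ θ₀ N (Φ N)).prod (lambertNoise (Fin 3))).map
          (fun p => lambertFlow (Torus.geometry (Fin 3)) (hsDiameter σ N) p.2 p.1 s))
      (localGibbsLaw σ (fun x => ρ s x * Rf (σ ^ 3 * ρ s x)) (u s) (θ s) N (Φ N))).toReal with hH
  have hH0 : ∀ N s, 0 ≤ H N s := fun N s => ENNReal.toReal_nonneg
  have hzero : Tendsto (fun N : ℕ => H N 0 / ((N : ℝ) + 1)) atTop (𝓝 0) := by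
    have h0 : ∀ N, H N 0 = 0 := by
      intro N
      haveI := isProbabilityMeasure_localGibbsLaw ha hθ hu ha0 hθ0 hσ2 N (Φ N)
      simp only [hH, hlaw N,
        Summit.AtomisticToContinuum.HydrodynamicLimit.Theorems.LambertianContactSwapLambertianEulerDock.map_lambertFlow_zero_localGibbsLaw
          hσ hσi ha hθ hu
          ha0 hθ0 N (Φ N), klDiv_self, ENNReal.toReal_zero]
    simp only [h0, zero_div]
    exact tendsto_const_nhds
  have hreal : Tendsto (fun N : ℕ => H N t / ((N : ℝ) + 1)) atTop (𝓝 0) :=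
    Summit.AtomisticToContinuum.HydrodynamicLimit.Theorems.LambertianContactSwapLambertianEulerDiscreteEntropyGronwallLog.discreteEntropyGronwall_log H ht.1 hH0 hzero hstep
  -- back to `ℝ≥0∞`
  have hcongr : ∀ N : ℕ, klDiv (((localGibbsLaw σ a₀ u₀ θ₀ N (Φ N)).prod (lambertNoise (Fin 3))).map
          (fun p => lambertFlow (Torus.geometry (Fin 3)) (hsDiameter σ N) p.2 p.1 t))
      (localGibbsLaw σ (fun x => ρ t x * Rf (σ ^ 3 * ρ t x)) (u t) (θ t) N (Φ N)) / ((N : ℝ≥0∞) + 1) =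
      ENNReal.ofReal (H N t / ((N : ℝ) + 1)) := by
    intro N
    have hNpos : (0 : ℝ) < (N : ℝ) + 1 := by positivity
    rw [ENNReal.ofReal_div_of_pos hNpos, hH, ENNReal.ofReal_toReal (hfin N t ⟨ht.1.le, le_rfl⟩)]
    congr 1
    rw [ENNReal.ofReal_add (by positivity) zero_le_one, ENNReal.ofReal_natCast, ENNReal.ofReal_one]
  simp only [hcongr]
  rw [← ENNReal.ofReal_zero]
  exact ENNReal.tendsto_ofReal hreal

end Summit.AtomisticToContinuum.HydrodynamicLimit.Theorems.LambertianContactSwapLambertianEulerOfHeartsInBand
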